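import Mathlib
import HarnessLib
import Summits.HubbardSuperconductivity.HubbardSuperconductivity.Theorems.KLProgrammeKLRegimeEngineTowerWtLawBaseTokX

/-!
# ♯5 «6LEG-INSIDE» (follows ♯4; «(b)-WT4-6LEG-CURRENCY», k3c2-p3 g17 KL STATUS l.12210, pen (R416)): THE RE-BASED ONE-TRACK WEIGHTED TOWER LAW WITH THE SIX-LEG
# MEASURED DATUM OF EVERY BLOCK `k ≥ 2` TAKEN FROM A BRIDGE ON THE LAW's OWN BORN ARRAYS (one block back) INSTEAD OF AN IMPORT ROW
# Route `KLProgramme` — crux K3 ENGINE (stmt-HubbardSuperconductivity-20437 `KLRegimeEngineV17F2`), stub (b) v2, THE WEIGHTED HALF «(b)-WT4»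
# (cell gate-hubbard-kl, seat hubbard-kl-k3c3-p2 g18; variant of W1 `klTowerBornWtAt_le_law_of_inputs_base_tokX` (p697412) on the SAME tokenised kit
#  `towerBorn_le_law_tracks_of_profile_base_tok`, whose `hprof3` hook already lets the degree-6 measured datum be read off the induction hypothesis; E1 may rename)

WHY.  The PLAIN six-leg line of `𝒱_{dk}[K_n]` is not `O(ε_j²)` uniformly in the level (the one-line 1PR tree term grows like `U²·4^j/klE0`), so the six-leg import
row `W·Z³·μ₃(k) ≤ ι₃·λ²` of W1 cannot be fed from a plain line at deep levels.  But the tower needs no import there: `𝒱_{dk} = 𝒱_{d(k−1)} + Δ_{k−1}`, the increment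
`Δ_{k−1}` is under the law's own `p = 3` clause at block `k−1` (born at `F_{d(k−1)}`; ONE weighted jump of `d−1` levels to the input family `F_{dk−1}` costs
`C₁C₂⁵·16^{d−1}` against the unit ratio `16^{d−1}` — ONE block back, no logarithm), and `𝒱_{d(k−1)}` is under its SECTORISED six-leg cell at level `d(k−1)` refined to
`dk−1` (k3c2-p3's `klWtPinnedSumOf_six_klTowerInput_jump_le_budget_klEng_flow_all`, budget-neutral).  This file is the generic layer: the kit's induction is run with
the six-leg measured datum of block `k ≥ 2` supplied by a BRIDGE hypothesis `hR3` from the induction hypothesis (the law on the born arrays of the blocks `2 … k`),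
block 1's by a row (`hι₃base`, the base); the six-leg measured rows of every block are EXPORTED as a fourth conjunct (the read-out at block `K_b` reads them).
* **`klTowerBornWtAt_le_law_of_inputs_base_tokX_six (j d Kb D)`** — W1's statement with `hι₃` replaced by `hι₃base` + `hR3` and the fourth conjunct added.
No model hypothesis is needed or assumed; the rate index `j`, the frame `K` and the block length `d` are free.
Composition of a landed theorem; nothing about the model is asserted; nothing asserts (b), (ℓ), any stub, K3 or superconductivity.
References: BGM 2006 §2.8 (2.83), (2.93)–(2.98), §3 (3.2)–(3.8) [cite: BenfattoGiulianiMastropietro2006].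
-/


noncomputable section

namespace Summit.HubbardSuperconductivity.HubbardSuperconductivity.Theorems.EngineV8

set_option linter.dupNamespace false -- summit = problem name (single-conjunct summit), D-0017

open Classical
open Real Finset Literature.MathematicalPhysics.QuantumLattice Literature.Probability.LatticeModels GrassmannAlgebra
open Literature.MathematicalPhysics.QuantumLattice.FermiRG
open Summit.HubbardSuperconductivity.HubbardSuperconductivity.Theorems.KLProgrammeLegKernels
open Summit.HubbardSuperconductivity.HubbardSuperconductivity.Theorems.KLRegimeSplit
open Summit.HubbardSuperconductivity.HubbardSuperconductivity.Theorems.DispersionFlow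

variable {L M : ℕ} [NeZero L] [NeZero M]

/-! ## The law with the six-leg bridge -/

/-- **THE RE-BASED ONE-TRACK WEIGHTED TOWER LAW WITH THE SIX-LEG BRIDGE** (variant of W1 `klTowerBornWtAt_le_law_of_inputs_base_tokX`; rate index `j`, frame `K`,
block length `d` free).  Inputs as W1's except the six-leg measured datum: a ROW at block 1 (`hι₃base`) and, at every block `2 ≤ k ≤ K_b`, a BRIDGE `hR3` from
the law on the born arrays of the blocks `2 … k`; conclusions as W1's plus the six-leg measured rows `W·Z³·μ₃(k) ≤ ι₃·λ²` of every block `1 ≤ k ≤ K_b`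
(exported for the read-out). [cite: BenfattoGiulianiMastropietro2006, §2.8 (2.83), (2.93)-(2.98)] -/
theorem klTowerBornWtAt_le_law_of_inputs_base_tokX_six {β : ℝ} (hβ : 0 < β) (U μ : ℝ) (K : TrigPolyC4v)
    (j d Kb D : ℕ) {A lam Q W Z A' Q' σ Φ ψ τ ι₁ ι₂ ι₃ : ℝ} {Zk : ℕ → Prop} (hD3 : 3 ≤ D)
    (hA : 0 ≤ A) (hlam : 0 < lam) (hQ : 0 ≤ Q) (hW : 0 ≤ W) (hZ : 0 ≤ Z) (hA'0 : 0 ≤ A') (hQ'0 : 0 < Q')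
    (hσ : 0 ≤ σ) (hΦ : 0 ≤ Φ) (hψ : 0 ≤ ψ) (hτ : 0 < τ)
    -- the base profile at block 1 (`𝒱_d` at `F_{d−1}`, rate `j`)
    (hbase : ∀ m, 4 ≤ m → m ≤ D →
      W * Z ^ m * (klTowerMeasWtAt L M β U μ K d 1 j (2 * m) / klLevUnitF β M 0 m (d * 1 - 1)) ≤ A' * lam ^ (m - 1) * Q' ^ m)
    -- the re-based re-measurement bridge at blocks 2 ≤ k ≤ Kb
    (hR : ∀ k, 2 ≤ k → k ≤ Kb →
      (∀ k', 2 ≤ k' → k' ≤ k → ∀ p, 3 ≤ p → p ≤ D →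
        klTowerBornWtAt L M β U μ K d (k' - 1) j (2 * p) / klLevUnitF β M 0 p (d * (k' - 1)) ≤ A * lam ^ (p - 1) * Q ^ p) →
      ∀ m, 4 ≤ m → m ≤ D →
        W * Z ^ m * (klTowerMeasWtAt L M β U μ K d k j (2 * m) / klLevUnitF β M 0 m (d * k - 1)) ≤ A' * lam ^ (m - 1) * Q' ^ m)
    -- the weighted imports (degrees 2, 4, 6) at every block 1 ≤ k ≤ Kb
    (hι₁ : ∀ k, 1 ≤ k → k ≤ Kb → W * Z ^ 1 * (klTowerMeasWtAt L M β U μ K d k j (2 * 1) / klLevUnitF β M 0 1 (d * k - 1)) ≤ ι₁ * lam)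
    (hι₂ : ∀ k, 1 ≤ k → k ≤ Kb → W * Z ^ 2 * (klTowerMeasWtAt L M β U μ K d k j (2 * 2) / klLevUnitF β M 0 2 (d * k - 1)) ≤ ι₂ * lam)
    -- the six-leg measured datum: at block 1 a ROW (the base), at blocks `2 ≤ k ≤ Kb` a BRIDGE from the law on the born arrays of the blocks `2 … k` (♯5 «6LEG-INSIDE»)
    (hι₃base : W * Z ^ 3 * (klTowerMeasWtAt L M β U μ K d 1 j (2 * 3) / klLevUnitF β M 0 3 (d * 1 - 1)) ≤ ι₃ * lam ^ 2)
    (hR3 : ∀ k, 2 ≤ k → k ≤ Kb →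
      (∀ k', 2 ≤ k' → k' ≤ k → ∀ p, 3 ≤ p → p ≤ D →
        klTowerBornWtAt L M β U μ K d (k' - 1) j (2 * p) / klLevUnitF β M 0 p (d * (k' - 1)) ≤ A * lam ^ (p - 1) * Q ^ p) →
      W * Z ^ 3 * (klTowerMeasWtAt L M β U μ K d k j (2 * 3) / klLevUnitF β M 0 3 (d * k - 1)) ≤ ι₃ * lam ^ 2)
    -- the token along the blocks («(ℓ)-Z-THREAD»): base, and propagation under the step's guard
    (hZ1 : Zk 1)
    (hZsucc : ∀ k, 1 ≤ k → k < Kb → Zk k →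
      Φ * towerV D τ (fun m => W * Z ^ m * (klTowerMeasWtAt L M β U μ K d k j (2 * m) / klLevUnitF β M 0 m (d * k - 1))) < 1 → Zk (k + 1))
    -- the weighted step at blocks 1 ≤ k < Kb (W2's LINK), which may use the token at its own block
    (hstep : ∀ k, 1 ≤ k → k < Kb → Zk k → ∀ N : ℕ, 2 ≤ N → ∀ p, 3 ≤ p → p ≤ D →
      Φ * towerV D τ (fun m => W * Z ^ m * (klTowerMeasWtAt L M β U μ K d k j (2 * m) / klLevUnitF β M 0 m (d * k - 1))) < 1 →
      klTowerBornWtAt L M β U μ K d k j (2 * p) / klLevUnitF β M 0 p (d * k) ≤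
        towerFO D σ (fun m => W * Z ^ m * (klTowerMeasWtAt L M β U μ K d k j (2 * m) / klLevUnitF β M 0 m (d * k - 1))) p +
          ∑ n ∈ Icc 2 N, exp 1 * Φ ^ (n - 1) * ψ ^ p *
            towerS D τ (fun m => W * Z ^ m * (klTowerMeasWtAt L M β U μ K d k j (2 * m) / klLevUnitF β M 0 m (d * k - 1))) n p +
          ψ ^ p * exp 1 * towerV D τ (fun m => W * Z ^ m * (klTowerMeasWtAt L M β U μ K d k j (2 * m) / klLevUnitF β M 0 m (d * k - 1))) *
            (Φ * towerV D τ (fun m => W * Z ^ m * (klTowerMeasWtAt L M β U μ K d k j (2 * m) / klLevUnitF β M 0 m (d * k - 1)))) ^ N /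
            (1 - Φ * towerV D τ (fun m => W * Z ^ m * (klTowerMeasWtAt L M β U μ K d k j (2 * m) / klLevUnitF β M 0 m (d * k - 1)))))
    -- the kit's numerics
    (hx₁ : 4 * σ * lam * Q' < 1) (hx₂ : 2 * lam * τ * Q' ≤ 1) (hx₃ : exp 1 * τ * lam * Q' < 1)
    (hy : Φ * (τ * (ι₁ * lam + ι₂ / (2 * Q') + ι₃ / (4 * Q' ^ 2) + A' * Q' / 4)) < 1)
    (hθ : Φ * (exp 1 * τ * (ι₁ * lam) + (exp 1 * τ) ^ 2 * (ι₂ * lam) + (exp 1 * τ) ^ 3 * (ι₃ * lam ^ 2) +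
      A' * (exp 1 * τ * Q') * ((exp 1 * τ * lam * Q') ^ 3 / (1 - exp 1 * τ * lam * Q'))) < 1)
    (hu₁ : 4 * Q' ≤ Q) (hu₂ : 2 * τ * ψ * Q' ≤ Q)
    (hclose : A' * (4 * Q') ^ 3 * (4 * σ * lam * Q' / (1 - 4 * σ * lam * Q')) +
      exp 1 * ψ * (2 * τ * ψ * Q') ^ 2 * (τ * (ι₁ * lam + ι₂ / (2 * Q') + ι₃ / (4 * Q' ^ 2) + A' * Q' / 4)) *
        (Φ * (τ * (ι₁ * lam + ι₂ / (2 * Q') + ι₃ / (4 * Q' ^ 2) + A' * Q' / 4)) /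
          (1 - Φ * (τ * (ι₁ * lam + ι₂ / (2 * Q') + ι₃ / (4 * Q' ^ 2) + A' * Q' / 4)))) ≤ A * Q ^ 3) :
    (∀ k, 1 ≤ k → k ≤ Kb → Zk k) ∧
    (∀ k, 2 ≤ k → k ≤ Kb → ∀ p : ℕ, 3 ≤ p → p ≤ D →
      klTowerBornWtAt L M β U μ K d (k - 1) j (2 * p) / klLevUnitF β M 0 p (d * (k - 1)) ≤ A * lam ^ (p - 1) * Q ^ p) ∧
    (∀ k, 1 ≤ k → k ≤ Kb → ∀ m, 4 ≤ m → m ≤ D →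
      W * Z ^ m * (klTowerMeasWtAt L M β U μ K d k j (2 * m) / klLevUnitF β M 0 m (d * k - 1)) ≤ A' * lam ^ (m - 1) * Q' ^ m) ∧
    (∀ k, 1 ≤ k → k ≤ Kb → W * Z ^ 3 * (klTowerMeasWtAt L M β U μ K d k j (2 * 3) / klLevUnitF β M 0 3 (d * k - 1)) ≤ ι₃ * lam ^ 2) := by
  -- the inline arrays
  set b : Unit → ℕ → ℕ → ℝ := fun _ k p => klTowerBornWtAt L M β U μ K d (k - 1) j (2 * p) / klLevUnitF β M 0 p (d * (k - 1)) with hb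
  set μw : ℕ → ℕ → ℝ := fun k m => W * Z ^ m * (klTowerMeasWtAt L M β U μ K d k j (2 * m) / klLevUnitF β M 0 m (d * k - 1)) with hμw
  have hprof : ∀ k, 1 ≤ k → k < Kb →
      (∀ k', 2 ≤ k' → k' ≤ k → ∀ t : Unit, ∀ p, 3 ≤ p → p ≤ D → b t k' p ≤ A * lam ^ (p - 1) * Q ^ p) →
      ∀ m, 4 ≤ m → m ≤ D → μw k m ≤ A' * lam ^ (m - 1) * Q' ^ m := by
    intro k hk1 hkK ih m hm hmD
    rcases Nat.lt_or_ge k 2 with hk | hk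
    · obtain rfl : k = 1 := by omega
      exact hbase m hm hmD
    · exact hR k hk hkK.le (fun k' hk'2 hk'le p hp hpD => ih k' hk'2 hk'le () p hp hpD) m hm hmD
  have hprof3 : ∀ k, 1 ≤ k → k < Kb → 3 ≤ D →
      (∀ k', 2 ≤ k' → k' ≤ k → ∀ t : Unit, ∀ p, 3 ≤ p → p ≤ D → b t k' p ≤ A * lam ^ (p - 1) * Q ^ p) →
      μw k 3 ≤ ι₃ * lam ^ 2 := by
    intro k hk1 hkK _ ih
    rcases Nat.lt_or_ge k 2 with hk | hk
    · obtain rfl : k = 1 := by omega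
      exact hι₃base
    · exact hR3 k hk hkK.le (fun k' hk'2 hk'le p hp hpD => ih k' hk'2 hk'le () p hp hpD)
  have hstep' : ∀ t : Unit, ∀ k, 1 ≤ k → k < Kb → Zk k → ∀ N : ℕ, 2 ≤ N → ∀ p, 3 ≤ p → p ≤ D → Φ * towerV D τ (μw k) < 1 →
      b t (k + 1) p ≤ towerFO D σ (μw k) p + ∑ n ∈ Icc 2 N, exp 1 * Φ ^ (n - 1) * ψ ^ p * towerS D τ (μw k) n p +
        ψ ^ p * exp 1 * towerV D τ (μw k) * (Φ * towerV D τ (μw k)) ^ N / (1 - Φ * towerV D τ (μw k)) := by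
    intro _ k hk1 hkK hZk N hN p hp hpD hguard
    have hbk : b () (k + 1) p = klTowerBornWtAt L M β U μ K d k j (2 * p) / klLevUnitF β M 0 p (d * k) := by
      simp only [hb, Nat.add_sub_cancel]
    rw [hbk]
    exact hstep k hk1 hkK hZk N hN p hp hpD hguard
  obtain ⟨hZall, hlaw⟩ := towerBorn_le_law_tracks_of_profile_base_tok (T := Unit) (K := Kb) (D := D) (b := b) (μ := μw)
    (A := A) (lam := lam) (Q := Q) (A' := A') (Q' := Q') (ι₁ := ι₁) (ι₂ := ι₂) (ι₃ := ι₃) (Zk := Zk) hD3 hlam hA hQ hσ hΦ hψ hτ hQ'0 hA'0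
    (fun k _ m => towerMuWt_nonneg hβ U μ K d k j m hW hZ) hZ1 hZsucc hprof hprof3
    (fun k hk1 hkK => hι₁ k hk1 hkK.le) (fun k hk1 hkK => hι₂ k hk1 hkK.le) hstep' hx₁ hx₂ hx₃ hy hθ hu₁ hu₂ hclose
  refine ⟨hZall, fun k hk2 hkK p hp hpD => hlaw k hk2 hkK () p hp hpD, fun k hk1 hkK m hm hmD => ?_, fun k hk1 hkK => ?_⟩
  · rcases Nat.lt_or_ge k 2 with hk | hk
    · obtain rfl : k = 1 := by omega
      exact hbase m hm hmD
    · exact hR k hk hkK (fun k' hk'2 hk'le p hp hpD => hlaw k' hk'2 (hk'le.trans hkK) () p hp hpD) m hm hmD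
  · rcases Nat.lt_or_ge k 2 with hk | hk
    · obtain rfl : k = 1 := by omega
      exact hι₃base
    · exact hR3 k hk hkK (fun k' hk'2 hk'le p hp hpD => hlaw k' hk'2 (hk'le.trans hkK) () p hp hpD)

end Summit.HubbardSuperconductivity.HubbardSuperconductivity.Theorems.EngineV8

end
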